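import Literature.NumberTheory.EllipticCurves.ShintaniLiftQExpansion
import HarnessLib

/-!
# The twisted Shintani lift is holomorphic and theta-automorphic

[[cite: Shintani1975, §2, Thm. 1]] (`Θ(z, φ)` is a holomorphic cusp form of weight `(2k+1)/2`) —
for the level-`64` twisted lift `Φ_D` we PROVE holomorphy from the `q`-series
`ShintaniLiftQExpansion.hasSum_liftCoeff` (a convergent `q`-series on `ℍ` is holomorphic,
`mdifferentiable_of_hasSum`) and record it together with the automorphy of `ShintaniLift`:
`mdifferentiable_shintaniLift`, `shintaniLift_mem_of_cusp` (membership in `S_{3/2}(256, 1)`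
GIVEN the vanishing at the cusps, the remaining analytic input).

No named facts, no new definitions.
-/

noncomputable section

open scoped MatrixGroups ModularForm Manifold
open UpperHalfPlane hiding I
open Complex Filter Topology CongruenceSubgroup
open Literature.NumberTheory.EllipticCurves.ModularForms

namespace Literature.NumberTheory.EllipticCurves.Shintani

variable (D : ℕ) [NeZero D]

/-- **`Φ_D` is holomorphic on `ℍ`** (`D` odd square-free, `φ ∈ S₂(Γ₀(64))`). [cite: Shintani1975, §2, Thm. 1] -/
theorem mdifferentiable_shintaniLift (hD : Odd D) (hDsq : Squarefree D) (f : CuspForm (Gamma0 64) 2) :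
    MDifferentiable 𝓘(ℂ) 𝓘(ℂ) (shintaniLift D f) :=
  mdifferentiable_of_hasSum (hasSum_liftCoeff D hD hDsq f)

/-- **`Φ_D ∈ S_{3/2}(256, 1)` given the cusp conditions**: holomorphy and automorphy are proved
(`mdifferentiable_shintaniLift`, `isThetaAutomorphic_shintaniLift`); the vanishing of
`slashSq 3 Φ_D g` at `i∞` for every `g ∈ SL₂(ℤ)` is taken as a hypothesis here. [cite: Shintani1975, §2, Thm. 1] -/
theorem shintaniLift_mem_of_cusp (hD : Odd D) (hDsq : Squarefree D) (f : CuspForm (Gamma0 64) 2)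
    (hcusp : ∀ g : SL(2, ℤ), IsZeroAtImInfty (slashSq 3 (shintaniLift D f) g)) :
    shintaniLift D f ∈ halfIntCuspForms 3 256 1 :=
  ⟨mdifferentiable_shintaniLift D hD hDsq f, isThetaAutomorphic_shintaniLift D hDsq hD f, hcusp⟩

end Literature.NumberTheory.EllipticCurves.Shintani
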